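import Literature.Computability.Complexity.GapSetCover
import Literature.Computability.Complexity.KSATReductions
import Literature.Computability.Complexity.PromiseProofs
import HarnessLib

/-!
# The promise problem `(SAT, UNSAT)` is NP-hard, and is Karp-equivalent to `ofLanguage SAT`

Topic `Computability/Complexity`, namespace `Literature.Computability.Complexity`. Glue for
reductions whose printed source is "given an instance `φ` of SAT" — a CNF formula, i.e. the
promise problem `satUnsatPromise` (`GapSetCover.lean`: YES = `SAT` = codes of satisfiable CNFs,
NO = `UNSAT` = codes of unsatisfiable CNFs, non-codewords off the promise) — when the consumer is
phrased for the language `SAT` as the promise problem `ofLanguage SAT` (NO = `SATᶜ`, which ALSO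
contains the non-codewords), e.g. `Literature.Algebra.EuclideanLattices.Khot2005_SAT_randReducible_gapSVP`
(`KhotSVPHardness.lean`) fed by `AroraEtAl1997_prop6` (`GapSetCover.lean`). Everything is PROVED,
library-first (no machine is written: the codeword test is `KSATRed.isCanonFn` of
`KSATReductions.lean`, the branch is `iteFn` of `BranchingFn.lean`):

* `satUnsatPromise_isNPHard` — **`(SAT, UNSAT)` is NP-hard under Karp reductions of promise
  problems**: the Cook–Levin reduction `x ↦ φₓ` of the tree (`CookLevin.reduceSAT`, Arora–Barak
  2009, Lemma 2.11, discharged in `CookLevinSAT.lean`) outputs the CODE of a CNF formula on every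
  input, satisfiable iff `x ∈ L`; so it maps `x ∉ L` into `UNSAT`, not merely into `SATᶜ`.
* `toSatUnsat`, `toSatUnsat_mem_FP`, `ofLanguage_SAT_polyTimeReducible_satUnsatPromise` — the Karp
  reduction `ofLanguage SAT → (SAT, UNSAT)`: a codeword (a string that re-encodes to itself,
  `KSATRed.isCanonFn`) is kept, any other string is sent to `KSATRed.badCode`, the code of the
  unsatisfiable CNF `[[]]` — the guarded identity of `KSATRed.kSATToSATFn` without the width test.
* `satUnsatPromise_polyTimeReducible_ofLanguage_SAT` (the identity the other way),
  `isHard_satUnsatPromise_iff` (`(SAT, UNSAT)` is `C`-hard iff `SAT` is),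
  `polyTimeReducible_ofLanguage_SAT_of_satUnsatPromise`, and the second proof of NP-hardness
  through `SAT_isNPHard_holds`.

## References

* S. Arora, B. Barak, *Computational Complexity: A Modern Approach*, CUP 2009, Lemma 2.11 and
  §2.3.4 (the reduction outputs a CNF formula `φₓ`), §2.3 (codes of formulas), §1.3 (closure of
  polynomial time under composition and case distinction).
* O. Goldreich, *On promise problems: a survey*, LNCS 3895 (2006), §1.1–1.2 and Def. 1.4 (Karp
  reductions among promise problems; a language as the promise problem `(L, Lᶜ)`).
-/

noncomputable section

namespace Literature.Computability.Complexity

open _root_.Computability CookLevin NegCNF KSATRed PromiseProblem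

/-! ### `(SAT, UNSAT)` is NP-hard: the Cook–Levin reduction lands in CNF codes -/

/-- **`(SAT, UNSAT)` is NP-hard** (Karp reductions of promise problems, `PromiseProblem.IsNPHard`):
for `L ∈ NP = polyExists P` presented by `(L', p)` and a polynomial-time decider `M` of `L'`
(`mem_P_iff_holds`), the Cook–Levin map `reduceSAT M p q : x ↦ code(φₓ)` (Arora–Barak 2009,
Lemma 2.11; `reduceSAT_mem_FP`, `reduceSAT_mem_SAT_iff`) sends `x ∈ L` to the code of a
satisfiable CNF and `x ∉ L` to the code of an UNSATISFIABLE CNF — "`x ∈ L ⇔ φₓ ∈ SAT`" with `φₓ`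
a CNF formula in both cases. [cite: AroraBarakCC2009, Lemma 2.11 (proof, §2.3.4)] -/
theorem satUnsatPromise_isNPHard : satUnsatPromise.IsNPHard := by
  rintro L ⟨L', hL', p, hp⟩
  obtain ⟨q, Mx, hM⟩ := mem_P_iff_holds.1 hL'
  have hiff := reduceSAT_mem_SAT_iff Mx p q
    (f := fun a => (L' : Set (List Bool)).boolIndicator a) (fun a => hM a)
  have hpres : ∀ x, x ∈ L ↔ reduceSAT Mx p q x ∈ SAT := fun x =>
    (hp x).trans ((exists_congr fun u => and_congr Iff.rfl
      (Set.mem_iff_boolIndicator (L' : Set (List Bool)) (boolPair x u))).trans (hiff x).symm)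
  refine ⟨reduceSAT Mx p q, reduceSAT_mem_FP Mx p q, fun x hx => ?_, fun x hx => ?_⟩
  · rw [satUnsatPromise_yes]
    exact (hpres x).1 hx
  · rw [satUnsatPromise_no]
    exact ⟨cnfN Mx p q x, fun hsat => hx ((hpres x).2 ((mem_SAT_iff _).2 hsat)), rfl⟩

/-! ### The reduction `ofLanguage SAT → (SAT, UNSAT)` -/

/-- `KSATRed.badCode ∈ UNSAT` (the CNF `[[]]` has an empty clause). [folklore] -/
theorem badCode_mem_UNSAT : badCode ∈ UNSAT :=
  ⟨[[]], CNF.not_satisfiable_of_nil_mem (φ := ([[]] : CNF ℕ)) (List.mem_singleton_self _), rfl⟩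

/-- **The reduction `ofLanguage SAT → (SAT, UNSAT)`**: keep codewords (`KSATRed.isCanonFn`), send
every other string to `KSATRed.badCode`. [cite: Goldreich2006, §1.1 and Def. 1.4] -/
def toSatUnsat : List Bool → List Bool :=
  iteFn isCanonFn id fun _ => badCode

/-- On a codeword the reduction is the identity. [folklore] -/
theorem toSatUnsat_encode (φ : CNF ℕ) : toSatUnsat (encodingCNF.encode φ) = encodingCNF.encode φ := by
  have h : isCanonFn (encodingCNF.encode φ) = [true] := by
    rw [isCanonFn_apply, KSATRed.decCNF_encode]
    simp
  exact iteFn_apply_true h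

/-- Off the codewords the reduction outputs `badCode`. [folklore] -/
theorem toSatUnsat_of_not_canon {z : List Bool} (hz : encodingCNF.encode (decCNF z) ≠ z) :
    toSatUnsat z = badCode := by
  have h : isCanonFn z = [false] := by
    rw [isCanonFn_apply]
    simp [hz]
  exact iteFn_apply_false h

/-- The reduction is in `FP` (`iteFn_mem_FP`, `isCanonFn_mem_FP`). [cite: AroraBarakCC2009, §1.3] -/
theorem toSatUnsat_mem_FP : toSatUnsat ∈ FP :=
  iteFn_mem_FP isCanonFn_mem_FP (PolyTimeComputable.id _) (const_mem_FP _)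

/-- **`ofLanguage SAT` Karp-reduces to `(SAT, UNSAT)`** (promise problems): `SAT ↦ SAT`
identically, and a string outside `SAT` is either the code of an unsatisfiable CNF (kept) or not
a codeword (sent to `badCode ∈ UNSAT`). [cite: Goldreich2006, §1.1 and Def. 1.4] -/
theorem ofLanguage_SAT_polyTimeReducible_satUnsatPromise :
    (ofLanguage SAT).PolyTimeReducible satUnsatPromise := by
  refine ⟨toSatUnsat, toSatUnsat_mem_FP, ?_, ?_⟩
  · rintro _ ⟨φ, hφ, rfl⟩
    rw [toSatUnsat_encode, satUnsatPromise_yes]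
    exact ⟨φ, hφ, rfl⟩
  · intro z hz
    rw [no_ofLanguage] at hz
    rw [satUnsatPromise_no]
    by_cases hcode : encodingCNF.encode (decCNF z) = z
    · rw [← hcode, toSatUnsat_encode]
      refine ⟨decCNF z, fun hsat => hz ?_, rfl⟩
      rw [← hcode]
      exact (mem_SAT_iff _).2 hsat
    · rw [toSatUnsat_of_not_canon hcode]
      exact badCode_mem_UNSAT

/-- **`(SAT, UNSAT)` Karp-reduces to `ofLanguage SAT`** by the identity (`UNSAT ⊆ SATᶜ`,
`SAT_disjoint_UNSAT`). [cite: Goldreich2006, §1.1 and Def. 1.4] -/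
theorem satUnsatPromise_polyTimeReducible_ofLanguage_SAT :
    satUnsatPromise.PolyTimeReducible (ofLanguage SAT) := by
  refine ⟨id, PolyTimeComputable.id _, fun z hz => hz, fun z hz hzSAT => ?_⟩
  exact Set.disjoint_left.1 SAT_disjoint_UNSAT hzSAT hz

/-- `(SAT, UNSAT)` is `C`-hard iff `SAT` is (`IsHard.of_reducible_holds` both ways,
`isHard_ofLanguage_iff`). [cite: Goldreich2006, §1.1 and Def. 1.4] -/
theorem isHard_satUnsatPromise_iff {C : Set (Language Bool)} :
    satUnsatPromise.IsHard C ↔ Complexity.IsHard C SAT := by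
  rw [← isHard_ofLanguage_iff]
  exact ⟨fun h => PromiseProblem.IsHard.of_reducible_holds h satUnsatPromise_polyTimeReducible_ofLanguage_SAT,
    fun h => PromiseProblem.IsHard.of_reducible_holds h ofLanguage_SAT_polyTimeReducible_satUnsatPromise⟩

/-- Second proof of `satUnsatPromise_isNPHard`, through the landed Cook–Levin fact
`SAT_isNPHard_holds` and the codeword-test reduction. [cite: AroraBarakCC2009, Lemma 2.11] -/
theorem satUnsatPromise_isNPHard' : satUnsatPromise.IsNPHard :=
  isHard_satUnsatPromise_iff.2 SAT_isNPHard_holds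

/-- Every problem to which `(SAT, UNSAT)` Karp-reduces is one to which `ofLanguage SAT`
Karp-reduces (`PolyTimeReducible.trans_holds`). [cite: Goldreich2006, Def. 1.4] -/
theorem polyTimeReducible_ofLanguage_SAT_of_satUnsatPromise {Q : PromiseProblem}
    (h : satUnsatPromise.PolyTimeReducible Q) : (ofLanguage SAT).PolyTimeReducible Q :=
  PolyTimeReducible.trans_holds ofLanguage_SAT_polyTimeReducible_satUnsatPromise h

/-- … and conversely (identity). [cite: Goldreich2006, Def. 1.4] -/
theorem polyTimeReducible_satUnsatPromise_of_ofLanguage_SAT {Q : PromiseProblem}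
    (h : (ofLanguage SAT).PolyTimeReducible Q) : satUnsatPromise.PolyTimeReducible Q :=
  PolyTimeReducible.trans_holds satUnsatPromise_polyTimeReducible_ofLanguage_SAT h

end Literature.Computability.Complexity
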